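import Literature.Probability.RandomPlanarGeometry.HexParafermion
import Literature.Probability.RandomPlanarGeometry.HexDomainSingleton
import Literature.Probability.Percolation.SitePaths
import HarnessLib

/-!
# Crux `SAWDevelopingMap.ObservableToSLE` (stmt-CriticalPhenomena-10472), line
`floor-ratio-restriction-bootstrap`, stub `stub_canonicalTransfer`: filling the holes of a
connected lattice set (lattice topology for the inner admissible discretisation (M1))

Landing target:
`Summits/CriticalPhenomena/SAWScalingLimit/Theorems/SAWDevelopingMapObservableToSLECanonicalTransferFill.lean`
(`--supports stmt-CriticalPhenomena-10472`).

The inner admissible domain of the discretisation (M1) (`…CanonicalTransferAssembly.lean`) is the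
FILL of the main component `G` of the deep lattice vertices of the Jordan domain: `G` together with
every vertex from which the lattice "infinity" (a far set `F`, e.g. the vertices outside a large
disc, mutually joined outside `G`) cannot be reached without crossing `G`.  This file is the purely
graph-theoretic part (paths are `Literature.Probability.Percolation.PathIn` chains of `hexGraph`):

* `pathIn_escaping` — a `Gᶜ`-path ending at an escaping vertex consists of escaping vertices;
* `exists_fill` = registered sub-goal `stub_canonicalTransfer_fill` — for `G` `PathIn`-connected,
  `F` with finite complement and pairwise joined in `Gᶜ`,
  and every vertex joined to `F` in the whole lattice, the fill
  `Λ = {z | ¬ ∃ w ∈ F, PathIn ℍ Gᶜ z w}` is a finite vertex set containing `G` which is SIMPLY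
  CONNECTED (`hexDomainSimplyConnected`: its complement, the escaping vertices, is connected) and
  CONNECTED (every vertex of `Λ` is joined to `G` inside `Λ`).
-/

noncomputable section

open Set
open Literature.Probability.LatticeModels (HexVertex hexGraph)
open Literature.Probability.RandomPlanarGeometry
open Literature.Probability.RandomPlanarGeometry.SAW
open Literature.Probability.Percolation (PathIn)

namespace Summit.CriticalPhenomena.SAWScalingLimit.Theorems.ObservableToSLE.FloorRatio

variable {V : Type*} {Γ : SimpleGraph V}

/-- **Escaping is inherited backwards along `A`-paths**: if `v` escapes (is joined inside `A` to
the far set `F`) then every `A`-path ending at `v` runs through escaping vertices only, hence is a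
path inside the escaping set. [folklore] -/
theorem pathIn_escaping {A F : Set V} {u v : V} (h : PathIn Γ A u v)
    (hv : ∃ w ∈ F, PathIn Γ A v w) : PathIn Γ {z | ∃ w ∈ F, PathIn Γ A z w} u v := by
  obtain ⟨hu, h⟩ := h
  induction h using Relation.ReflTransGen.head_induction_on with
  | refl => exact PathIn.refl hv
  | @head b c hbc _ ih =>
    have hb : b ∈ A := hu
    have hc : PathIn Γ {z | ∃ w ∈ F, PathIn Γ A z w} c v := ih hbc.2
    have hcesc : ∃ w ∈ F, PathIn Γ A c w := hc.left_mem
    have hbesc : ∃ w ∈ F, PathIn Γ A b w := by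
      obtain ⟨w, hw, hcw⟩ := hcesc
      exact ⟨w, hw, (PathIn.of_adj hb hbc.2 hbc.1).trans hcw⟩
    exact (PathIn.of_adj (A := {z | ∃ w ∈ F, PathIn Γ A z w}) hbesc hcesc hbc.1).trans hc

/-- A vertex of `A` adjacent to an escaping vertex escapes. [folklore] -/
theorem escaping_of_adj {A F : Set V} {b c : V} (hb : b ∈ A) (hbc : Γ.Adj b c)
    (hc : ∃ w ∈ F, PathIn Γ A c w) : ∃ w ∈ F, PathIn Γ A b w := by
  obtain ⟨w, hw, hcw⟩ := hc
  exact ⟨w, hw, (PathIn.of_adj hb hcw.left_mem hbc).trans hcw⟩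

/-- **The fill of a connected lattice set** (named form of the registered sub-goal
`stub_canonicalTransfer_fill`).  Let `G` be a set of honeycomb vertices, `PathIn`-connected
inside itself; let `F` ("far" vertices) have finite complement, any two of its vertices
joined by a lattice path avoiding `G`, and every vertex joined to `F` by some lattice path.  Then
the fill `Λ = {z | ¬ ∃ w ∈ F, PathIn ℍ Gᶜ z w}` (the vertices that cannot reach `F` without
crossing `G`) is a finite vertex set containing `G`, simply connected (connected complement) and
connected. [folklore] -/
theorem exists_fill {G F : Set HexVertex}
    (hG : ∀ x ∈ G, ∀ y ∈ G, PathIn hexGraph G x y) (hfin : Fᶜ.Finite)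
    (hF : ∀ w₁ ∈ F, ∀ w₂ ∈ F, PathIn hexGraph Gᶜ w₁ w₂)
    (hreach : ∀ z : HexVertex, ∃ w ∈ F, PathIn hexGraph univ z w) :
    ∃ Λ : Finset HexVertex, G ⊆ ↑Λ ∧ hexDomainSimplyConnected Λ ∧
      (hexGraph.induce (↑Λ : Set HexVertex)).Preconnected ∧
      ∀ z : HexVertex, z ∈ Λ ↔ ¬ ∃ w ∈ F, PathIn hexGraph Gᶜ z w := by
  classical
  set Esc : Set HexVertex := {z | ∃ w ∈ F, PathIn hexGraph Gᶜ z w} with hEsc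
  -- far vertices escape, so the fill is finite
  have hFG : F ⊆ Gᶜ := fun w hw => (hF w hw w hw).left_mem
  have hFesc : F ⊆ Esc := fun w hw => ⟨w, hw, PathIn.refl (hFG hw)⟩
  have hfinΛ : (Escᶜ).Finite := hfin.subset (compl_subset_compl.2 hFesc)
  refine ⟨hfinΛ.toFinset, ?_, ?_, ?_, fun z => by rw [Finite.mem_toFinset]; rfl⟩
  · -- `G ⊆ Λ`
    intro z hz
    rw [Finite.coe_toFinset]
    rintro ⟨w, -, hzw⟩
    exact hzw.left_mem hz
  · -- simply connected: the escaping set is connected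
    unfold hexDomainSimplyConnected
    rw [Finite.coe_toFinset, compl_compl]
    refine preconnected_induce_of_forall_pathIn fun x hx y hy => ?_
    obtain ⟨w₁, hw₁, hxw₁⟩ := hx
    obtain ⟨w₂, hw₂, hyw₂⟩ := id hy
    have hxy : PathIn hexGraph Gᶜ x y := (hxw₁.trans (hF w₁ hw₁ w₂ hw₂)).trans hyw₂.symm
    exact pathIn_escaping hxy hy
  · -- connected: every vertex of the fill is joined to `G` inside the fill
    have key : ∀ z ∈ Escᶜ, ∃ g ∈ G, PathIn hexGraph Escᶜ z g := by
      intro z hz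
      obtain ⟨w, hw, hzw⟩ := hreach z
      have hwR : w ∉ Escᶜ := fun h => h (hFesc hw)
      obtain ⟨a, b, ha, hb, -, hab, hza⟩ := hzw.exit (R := Escᶜ) hz hwR
      rw [inter_univ] at hza
      refine ⟨a, ?_, hza⟩
      by_contra haG
      exact ha (escaping_of_adj (A := Gᶜ) haG hab (not_notMem.1 hb))
    have hGΛ : G ⊆ Escᶜ := fun z hz ⟨w, _, hzw⟩ => hzw.left_mem hz
    rw [Finite.coe_toFinset]
    refine preconnected_induce_of_forall_pathIn fun x hx y hy => ?_
    obtain ⟨gx, hgx, hxg⟩ := key x hx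
    obtain ⟨gy, hgy, hyg⟩ := key y hy
    exact (hxg.trans ((hG gx hgx gy hgy).mono hGΛ)).trans hyg.symm

/-- **Registered sub-goal `stub_canonicalTransfer_fill`** (crux item stmt-CriticalPhenomena-10472,
line `floor-ratio-restriction-bootstrap`, stub `stub_canonicalTransfer`): the fill of a connected
lattice set, registry form of `exists_fill`. [folklore] -/
theorem stub_canonicalTransfer_fill :
    ∀ (G F : Set HexVertex), (∀ x ∈ G, ∀ y ∈ G, PathIn hexGraph G x y) →
    Fᶜ.Finite → (∀ w₁ ∈ F, ∀ w₂ ∈ F, PathIn hexGraph Gᶜ w₁ w₂) →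
    (∀ z : HexVertex, ∃ w ∈ F, PathIn hexGraph univ z w) →
    ∃ Λ : Finset HexVertex, G ⊆ ↑Λ ∧ hexDomainSimplyConnected Λ ∧
      (hexGraph.induce (↑Λ : Set HexVertex)).Preconnected ∧
      ∀ z : HexVertex, z ∈ Λ ↔ ¬ ∃ w ∈ F, PathIn hexGraph Gᶜ z w :=
  fun _ _ hG hfin hF hreach => exists_fill hG hfin hF hreach

end Summit.CriticalPhenomena.SAWScalingLimit.Theorems.ObservableToSLE.FloorRatio

end
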